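import Literature.Analysis.FunctionSpaces.PoissonMecke
import Mathlib.Probability.Independence.Basic
import Mathlib.MeasureTheory.Constructions.Pi
import HarnessLib

/-!
# Towards the Mecke equation from Kingman's axioms, II: additivity of counts, atoms of a finite
# family of sets, count cylinders, independent Poisson counts
(trunk T-KINETIC; topic Analysis/FunctionSpaces, next to `PoissonMecke`; proofs towards the named
fact `Literature.Analysis.FunctionSpaces.IsPoissonPointProcess.multivariateMecke`,
Last–Penrose 2017 Thm 4.4)

The Mecke equation will be proved as an equality of two measures on `PointConfig E × E` (the
Campbell measure of the process and the "insertion" measure), checked on a generating π-system.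
This file provides the combinatorial and probabilistic inputs, with no new definitions:

* **Additivity of counts** over finite disjoint unions (`PointConfig.count_biUnion_finset`), and
  the counts of a set of possibly infinite intensity through a monotone exhaustion
  (`PointConfig.count_eq_natCast_iff_eventually`: `N(s) = k` iff eventually `N(s ∩ S_m) = k`).
* **Atoms** of a finite family `t : Fin q → Set E`: the sets `⋂ⱼ (t j or (t j)ᶜ according to w j)`,
  `w : Fin q → Bool`, are pairwise disjoint and measurable, each `t j` is the disjoint union of the
  atoms with `w j = true`, so `N(t j) = ∑_{w j} N(atom w)` (`PointConfig.count_eq_sum_count_atom`).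
  This refines an arbitrary count cylinder to counts of disjoint sets, to which Kingman's
  independence axiom applies.
* **Count cylinders** `{c | ∀ j, N_c(s j) = k j}` (finitely many measurable `s j` of finite
  intensity, `k j ∈ ℕ`) form a π-system containing `univ` which generates the count σ-algebra
  (`PointConfig.generateFrom_countCylinders`; for `ν s = ∞` the fibres of `N(s)` are recovered
  through a monotone exhaustion by sets of finite intensity); on `E` the measurable sets of finite
  intensity generate (`PointConfig.generateFrom_finiteMeasure_eq`). Both families are countably
  spanning, as `Mathlib`'s `generateFrom_prod_eq` and `Measure.ext_of_generateFrom_of_iUnion`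
  require.
* **Independent Poisson counts** (`IsPoissonPointProcess.lintegral_mul_eq_of_iIndepFun_poisson`):
  for finitely many independent `ℕ∞`-valued counts `N_w ~ Po(λ_w)`,
  `𝔼[N_w · G(N)] = λ_w · 𝔼[G(N + e_w)]` for every `G ≥ 0` — the elementary identity
  `k · Po(λ)(k) = λ · Po(λ)(k-1)` behind the Mecke equation (Last–Penrose 2017, proof of Thm 4.1
  via Prop. 3.5/(3.?) for finite intensity; here read off the product law of the count vector).

## References

* G. Last, M. Penrose, *Lectures on the Poisson Process*, Cambridge Univ. Press (2017), Ch. 3–4,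
  Thm 4.1, Thm 4.4.
* J. F. C. Kingman, *Poisson Processes*, Oxford (1993), §2.1.
-/

open MeasureTheory ProbabilityTheory Filter Set TopologicalSpace
open scoped ENNReal NNReal Topology

namespace Literature.Analysis.FunctionSpaces

namespace PointConfig

variable {E : Type*} [TopologicalSpace E]

/-! ## Finite additivity of the counting function -/

/-- Additivity of the counting function over a disjoint union. [folklore] -/
theorem count_union_of_disjoint (c : PointConfig E) {s t : Set E} (h : Disjoint s t) :
    c.count (s ∪ t) = c.count s + c.count t := by
  rw [count, count, count, inter_union_distrib_left]
  exact Set.encard_union_eq (h.mono inter_subset_right inter_subset_right)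

/-- **Finite additivity of the counting function**: for a finite pairwise disjoint family,
`N_c(⋃ᵢ t i) = ∑ᵢ N_c(t i)` (in `ℕ∞`). [folklore] -/
theorem count_biUnion_finset {ι : Type*} (c : PointConfig E) (F : Finset ι) (t : ι → Set E)
    (hd : (F : Set ι).PairwiseDisjoint t) : c.count (⋃ i ∈ F, t i) = ∑ i ∈ F, c.count (t i) := by
  classical
  induction F using Finset.induction_on with
  | empty => simp [count]
  | insert a F haF ih =>
    rw [Finset.set_biUnion_insert, Finset.sum_insert haF, Finset.coe_insert] at *
    have hd' : (F : Set ι).PairwiseDisjoint t := hd.subset (subset_insert _ _)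
    rw [count_union_of_disjoint, ih hd']
    rw [Set.disjoint_iUnion₂_right]
    intro i hi
    exact hd (mem_insert _ _) (mem_insert_of_mem _ hi) (fun h => haF (h ▸ hi))

/-! ## Counts of a set of infinite intensity through a monotone exhaustion -/

/-- **Counting through a monotone exhaustion**: for a monotone sequence `S_m ↑ E`,
`N_c(s) = k` iff `N_c(s ∩ S_m) = k` for all large `m` (a finite set of points lies in some `S_n`;
conversely nested finite sets of equal size coincide). Used to generate the fibres of `N(s)` for
`ν s = ∞` from counts of sets of finite intensity. [folklore] -/
theorem count_eq_natCast_iff_eventually (c : PointConfig E) (s : Set E) {S : ℕ → Set E}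
    (hmono : Monotone S) (hU : (⋃ n, S n) = univ) (k : ℕ) :
    c.count s = k ↔ ∃ n, ∀ m, n ≤ m → c.count (s ∩ S m) = k := by
  constructor
  · intro h
    have hfin : (c.carrier ∩ s).Finite := by
      rw [← Set.encard_lt_top_iff, ← count, h]; exact ENat.coe_lt_top k
    obtain ⟨I, hI, hsub⟩ := Set.finite_subset_iUnion hfin (show c.carrier ∩ s ⊆ ⋃ n, S n by
      rw [hU]; exact subset_univ _)
    refine ⟨hI.toFinset.sup id, fun m hm => ?_⟩
    have hsub' : c.carrier ∩ s ⊆ S m := by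
      intro x hx
      obtain ⟨i, hi, hxi⟩ := mem_iUnion₂.1 (hsub hx)
      have him : i ≤ m := le_trans (Finset.le_sup (f := id) (hI.mem_toFinset.2 hi)) hm
      exact hmono him hxi
    rw [← h, count, count, ← inter_assoc, inter_eq_left.2 (fun x hx => hsub' hx)]
  · rintro ⟨n, hn⟩
    have hTfin : ∀ m, n ≤ m → (c.carrier ∩ (s ∩ S m)).Finite := fun m hm => by
      rw [← Set.encard_lt_top_iff, ← count, hn m hm]; exact ENat.coe_lt_top k
    have hTeq : ∀ m, n ≤ m → c.carrier ∩ (s ∩ S n) = c.carrier ∩ (s ∩ S m) := fun m hm => by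
      refine Set.Finite.eq_of_subset_of_encard_le (hTfin n le_rfl)
        (inter_subset_inter_right _ (inter_subset_inter_right _ (hmono hm))) ?_
      rw [← count, ← count, hn m hm, hn n le_rfl]
    have hall : c.carrier ∩ s = c.carrier ∩ (s ∩ S n) := by
      apply subset_antisymm
      · intro x hx
        obtain ⟨m, hm⟩ : ∃ m, x ∈ S m := by
          have : x ∈ (⋃ m, S m) := by rw [hU]; exact mem_univ _
          exact mem_iUnion.1 this
        have hx' : x ∈ c.carrier ∩ (s ∩ S (max n m)) := ⟨hx.1, hx.2, hmono (le_max_right _ _) hm⟩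
        rwa [← hTeq (max n m) (le_max_left _ _)] at hx'
      · exact inter_subset_inter_right _ inter_subset_left
    rw [count, hall, ← count, hn n le_rfl]

/-! ## Atoms of a finite family of sets -/

section Atoms

variable {q : ℕ} (t : Fin q → Set E)

omit [TopologicalSpace E] in
/-- Membership in the atom of pattern `w` of the family `t`: `x` lies in exactly the `t j` with
`w j = true`. [folklore] -/
theorem mem_atom_iff (w : Fin q → Bool) (x : E) :
    x ∈ (⋂ j, bif w j then t j else (t j)ᶜ) ↔ ∀ j, (x ∈ t j ↔ w j = true) := by
  simp only [mem_iInter]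
  refine forall_congr' fun j => ?_
  cases w j <;> simp

omit [TopologicalSpace E] in
/-- Atoms of distinct patterns are disjoint. [folklore] -/
theorem disjoint_atom {w w' : Fin q → Bool} (h : w ≠ w') :
    Disjoint (⋂ j, bif w j then t j else (t j)ᶜ) (⋂ j, bif w' j then t j else (t j)ᶜ) := by
  obtain ⟨j, hj⟩ : ∃ j, w j ≠ w' j := Function.ne_iff.1 h
  rw [Set.disjoint_left]
  intro x hx hx'
  rw [mem_atom_iff] at hx hx'
  exact hj (by rw [Bool.eq_iff_iff, ← hx j, ← hx' j])

omit [TopologicalSpace E] in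
/-- The atoms form a pairwise disjoint family. [folklore] -/
theorem pairwiseDisjoint_atom (F : Set (Fin q → Bool)) :
    F.PairwiseDisjoint fun w => ⋂ j, bif w j then t j else (t j)ᶜ :=
  fun _ _ _ _ h => disjoint_atom t h

omit [TopologicalSpace E] in
/-- Each set of the family is the (disjoint) union of the atoms whose pattern selects it.
[folklore] -/
theorem eq_biUnion_atom (j : Fin q) :
    t j = ⋃ w ∈ (Finset.univ.filter fun w : Fin q → Bool => w j = true),
      ⋂ i, bif w i then t i else (t i)ᶜ := by
  classical
  ext x
  simp only [mem_iUnion, Finset.mem_filter, Finset.mem_univ, true_and, exists_prop]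
  constructor
  · intro hx
    refine ⟨fun i => decide (x ∈ t i), by simpa using hx, ?_⟩
    rw [mem_atom_iff]
    intro i
    simp
  · rintro ⟨w, hw, hx⟩
    rw [mem_atom_iff] at hx
    exact (hx j).2 hw

omit [TopologicalSpace E] in
/-- An atom whose pattern selects `t j` lies inside `t j` (so it has finite intensity when
`t j` has). [folklore] -/
theorem atom_subset {w : Fin q → Bool} {j : Fin q} (hj : w j = true) :
    (⋂ i, bif w i then t i else (t i)ᶜ) ⊆ t j := fun x hx => by
  rw [mem_atom_iff] at hx
  exact (hx j).2 hj

omit [TopologicalSpace E] in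
/-- Atoms of measurable sets are measurable. [folklore] -/
theorem measurableSet_atom [MeasurableSpace E] (ht : ∀ j, MeasurableSet (t j)) (w : Fin q → Bool) :
    MeasurableSet (⋂ j, bif w j then t j else (t j)ᶜ) :=
  MeasurableSet.iInter fun j => by cases w j <;> simp [ht j, (ht j).compl]

/-- **A count is the sum of the counts of atoms**: `N_c(t j) = ∑_{w : w j} N_c(atom w)`.
[folklore] -/
theorem count_eq_sum_count_atom (c : PointConfig E) (j : Fin q) :
    c.count (t j) = ∑ w ∈ (Finset.univ.filter fun w : Fin q → Bool => w j = true),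
      c.count (⋂ i, bif w i then t i else (t i)ᶜ) := by
  conv_lhs => rw [eq_biUnion_atom t j]
  exact count_biUnion_finset c _ _ (pairwiseDisjoint_atom t _)

end Atoms

/-! ## The count cylinders: a generating π-system of the count σ-algebra -/

section Cylinders

variable [MeasurableSpace E] (ν : Measure E)

/-- **The count cylinders form a π-system**: the intersection of the cylinders of two finite
families is the cylinder of the concatenated family (`Fin.append`). (Kingman 1993 §2.1; Rényi's
theorem, cf. the named fact `IsPoissonPointProcess.unique`.) [folklore] -/
theorem isPiSystem_countCylinders :
    IsPiSystem {A : Set (PointConfig E) | ∃ (r : ℕ) (s : Fin r → Set E) (k : Fin r → ℕ),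
      (∀ j, MeasurableSet (s j) ∧ ν (s j) ≠ ∞) ∧ A = {c | ∀ j, c.count (s j) = (k j : ℕ∞)}} := by
  rintro A ⟨r, s, k, hs, rfl⟩ A' ⟨r', s', k', hs', rfl⟩ -
  refine ⟨r + r', Fin.append s s', Fin.append k k', fun j => ?_, ?_⟩
  · induction j using Fin.addCases with
    | left i => simpa only [Fin.append_left] using hs i
    | right i => simpa only [Fin.append_right] using hs' i
  · ext c
    simp only [mem_inter_iff, mem_setOf_eq]
    constructor
    · rintro ⟨h, h'⟩ j
      induction j using Fin.addCases with
      | left i => simpa only [Fin.append_left] using h i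
      | right i => simpa only [Fin.append_right] using h' i
    · intro h
      exact ⟨fun i => by simpa only [Fin.append_left] using h (Fin.castAdd r' i),
        fun i => by simpa only [Fin.append_right] using h (Fin.natAdd r i)⟩

/-- The whole space is the cylinder of the empty family. [folklore] -/
theorem univ_mem_countCylinders :
    (univ : Set (PointConfig E)) ∈ {A : Set (PointConfig E) | ∃ (r : ℕ) (s : Fin r → Set E) (k : Fin r → ℕ),
      (∀ j, MeasurableSet (s j) ∧ ν (s j) ≠ ∞) ∧ A = {c | ∀ j, c.count (s j) = (k j : ℕ∞)}} :=
  ⟨0, Fin.elim0, Fin.elim0, fun j => j.elim0, by ext c; simp⟩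

/-- The count cylinders are countably spanning (they contain `univ`). [folklore] -/
theorem isCountablySpanning_countCylinders :
    IsCountablySpanning {A : Set (PointConfig E) | ∃ (r : ℕ) (s : Fin r → Set E) (k : Fin r → ℕ),
      (∀ j, MeasurableSet (s j) ∧ ν (s j) ≠ ∞) ∧ A = {c | ∀ j, c.count (s j) = (k j : ℕ∞)}} :=
  ⟨fun _ => univ, fun _ => univ_mem_countCylinders ν, iUnion_const _⟩

/-- A count cylinder is measurable for the count σ-algebra. [folklore] -/
theorem measurableSet_setOf_count_eq {r : ℕ} {s : Fin r → Set E} (hs : ∀ j, MeasurableSet (s j))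
    (k : Fin r → ℕ) : MeasurableSet {c : PointConfig E | ∀ j, c.count (s j) = (k j : ℕ∞)} := by
  have : {c : PointConfig E | ∀ j, c.count (s j) = (k j : ℕ∞)} = ⋂ j, (fun c => c.count (s j)) ⁻¹' {(k j : ℕ∞)} := by
    ext c; simp
  rw [this]
  exact MeasurableSet.iInter fun j => measurable_count (hs j) (measurableSet_singleton _)

/-- Members of the cylinder family are measurable. [folklore] -/
theorem measurableSet_of_mem_countCylinders {A : Set (PointConfig E)}
    (hA : A ∈ {A : Set (PointConfig E) | ∃ (r : ℕ) (s : Fin r → Set E) (k : Fin r → ℕ),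
      (∀ j, MeasurableSet (s j) ∧ ν (s j) ≠ ∞) ∧ A = {c | ∀ j, c.count (s j) = (k j : ℕ∞)}}) :
    MeasurableSet A := by
  obtain ⟨r, s, k, hs, rfl⟩ := hA
  exact measurableSet_setOf_count_eq (fun j => (hs j).1) k

/-- A fibre `{N(s) = k}` of the count of a set of finite intensity is a cylinder. [folklore] -/
theorem setOf_count_eq_mem_countCylinders {s : Set E} (hs : MeasurableSet s) (hfin : ν s ≠ ∞) (k : ℕ) :
    {c : PointConfig E | c.count s = (k : ℕ∞)} ∈ {A : Set (PointConfig E) | ∃ (r : ℕ) (s : Fin r → Set E) (k : Fin r → ℕ),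
      (∀ j, MeasurableSet (s j) ∧ ν (s j) ≠ ∞) ∧ A = {c | ∀ j, c.count (s j) = (k j : ℕ∞)}} :=
  ⟨1, fun _ => s, fun _ => k, fun _ => ⟨hs, hfin⟩, by ext c; simp⟩

/-- **The count cylinders generate the count σ-algebra** (σ-finite intensity): each counting map
`N(s)` is measurable for the generated σ-algebra — for `ν s < ∞` its fibres over `k ∈ ℕ` are
cylinders and `{N(s) = ∞}` is the complement of their union; for general `s`, `{N(s) = k}` is
`⋃ₙ ⋂_{m ≥ n} {N(s ∩ S_m) = k}` along a monotone exhaustion `S_m` by sets of finite intensity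
(`count_eq_natCast_iff_eventually`). This is the generating π-system of Rényi's uniqueness
theorem (Kingman 1993 §3.4). [cite: Kingman1993, §2.1] -/
theorem generateFrom_countCylinders [SigmaFinite ν] :
    MeasurableSpace.generateFrom {A : Set (PointConfig E) | ∃ (r : ℕ) (s : Fin r → Set E) (k : Fin r → ℕ),
      (∀ j, MeasurableSet (s j) ∧ ν (s j) ≠ ∞) ∧ A = {c | ∀ j, c.count (s j) = (k j : ℕ∞)}} =
      (PointConfig.instMeasurableSpace : MeasurableSpace (PointConfig E)) := by
  set C := {A : Set (PointConfig E) | ∃ (r : ℕ) (s : Fin r → Set E) (k : Fin r → ℕ),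
      (∀ j, MeasurableSet (s j) ∧ ν (s j) ≠ ∞) ∧ A = {c | ∀ j, c.count (s j) = (k j : ℕ∞)}} with hC
  apply le_antisymm
  · exact MeasurableSpace.generateFrom_le fun A hA => measurableSet_of_mem_countCylinders ν hA
  · -- fibres of the counting maps are generated
    have hfib : ∀ {s : Set E}, MeasurableSet s → ν s ≠ ∞ → ∀ k : ℕ,
        MeasurableSet[MeasurableSpace.generateFrom C] {c : PointConfig E | c.count s = k} :=
      fun hs hfin k => MeasurableSpace.measurableSet_generateFrom (setOf_count_eq_mem_countCylinders ν hs hfin k)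
    -- spanning sets, made monotone
    set S : ℕ → Set E := fun n => ⋃ i ∈ Finset.range (n + 1), spanningSets ν i with hS
    have hSm : ∀ n, MeasurableSet (S n) := fun n =>
      MeasurableSet.biUnion (Finset.range (n + 1)).countable_toSet fun i _ => measurableSet_spanningSets ν i
    have hSfin : ∀ n, ν (S n) ≠ ∞ := fun n =>
      (measure_biUnion_lt_top (Finset.range (n + 1)).finite_toSet fun i _ =>
        measure_spanningSets_lt_top ν i).ne
    have hSmono : Monotone S := fun n m hnm => by
      refine Set.biUnion_subset_biUnion_left fun i hi => ?_
      simp only [Finset.coe_range, mem_Iio] at hi ⊢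
      omega
    have hSU : (⋃ n, S n) = univ := by
      refine eq_univ_of_forall fun x => mem_iUnion.2 ⟨spanningSetsIndex ν x, ?_⟩
      exact mem_biUnion (Finset.mem_coe.2 (Finset.self_mem_range_succ _)) (mem_spanningSetsIndex ν x)
    -- fibres of the counting map of an arbitrary measurable set
    have hfib' : ∀ {s : Set E}, MeasurableSet s → ∀ k : ℕ,
        MeasurableSet[MeasurableSpace.generateFrom C] {c : PointConfig E | c.count s = k} := by
      intro s hs k
      have hset : {c : PointConfig E | c.count s = k} =
          ⋃ n, ⋂ m, ⋂ (_ : n ≤ m), {c : PointConfig E | c.count (s ∩ S m) = k} := by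
        ext c
        simp only [mem_setOf_eq, mem_iUnion, mem_iInter]
        exact c.count_eq_natCast_iff_eventually s hSmono hSU k
      rw [hset]
      refine MeasurableSet.iUnion fun n => MeasurableSet.iInter fun m => MeasurableSet.iInter fun _ => ?_
      exact hfib (hs.inter (hSm m)) (ne_top_of_le_ne_top (hSfin m) (measure_mono inter_subset_right)) k
    have htop : ∀ {s : Set E}, MeasurableSet s →
        MeasurableSet[MeasurableSpace.generateFrom C] {c : PointConfig E | c.count s = ⊤} := by
      intro s hs
      have hset : {c : PointConfig E | c.count s = ⊤} = (⋃ k : ℕ, {c : PointConfig E | c.count s = k})ᶜ := by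
        ext c
        simp only [mem_setOf_eq, mem_compl_iff, mem_iUnion, not_exists]
        constructor
        · intro h k hk; rw [hk] at h; exact ENat.coe_ne_top k h
        · intro h
          by_contra hne
          obtain ⟨k, hk⟩ := ENat.ne_top_iff_exists.1 hne
          exact h k hk.symm
      rw [hset]
      exact (MeasurableSet.iUnion fun k => hfib' hs k).compl
    -- conclude: every counting map is measurable for the generated σ-algebra
    refine iSup₂_le fun s hs => ?_
    rw [← measurable_iff_comap_le]
    refine @measurable_to_countable' ℕ∞ (PointConfig E) _ _ (MeasurableSpace.generateFrom C)
      (fun c : PointConfig E => c.count s) fun y => ?_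
    induction y using ENat.recTopCoe with
    | top => exact htop hs
    | coe k => exact hfib' hs k

omit [TopologicalSpace E] in
/-- For a σ-finite measure the measurable sets of finite measure generate the σ-algebra.
[folklore] -/
theorem generateFrom_finiteMeasure_eq [SigmaFinite ν] :
    MeasurableSpace.generateFrom {B : Set E | MeasurableSet B ∧ ν B ≠ ∞} = ‹MeasurableSpace E› := by
  apply le_antisymm
  · exact MeasurableSpace.generateFrom_le fun B hB => hB.1
  · intro B hB
    have : B = ⋃ n, B ∩ spanningSets ν n := by
      rw [← inter_iUnion, iUnion_spanningSets, inter_univ]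
    rw [this]
    exact MeasurableSet.iUnion fun n => MeasurableSpace.measurableSet_generateFrom
      ⟨hB.inter (measurableSet_spanningSets ν n),
        (ne_top_of_le_ne_top (measure_spanningSets_lt_top ν n).ne (measure_mono inter_subset_right))⟩

omit [TopologicalSpace E] in
/-- For a σ-finite measure the measurable sets of finite measure are countably spanning.
[folklore] -/
theorem isCountablySpanning_finiteMeasure [SigmaFinite ν] :
    IsCountablySpanning {B : Set E | MeasurableSet B ∧ ν B ≠ ∞} :=
  ⟨spanningSets ν, fun n => ⟨measurableSet_spanningSets ν n, (measure_spanningSets_lt_top ν n).ne⟩,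
    iUnion_spanningSets ν⟩

end Cylinders

end PointConfig

/-! ## Independent Poisson counts: `𝔼[N_w G(N)] = λ_w 𝔼[G(N + e_w)]` -/

namespace IsPoissonPointProcess

/-- The Poisson law transported to `ℕ∞`: mass `e^{-r} rᵏ/k!` at `k : ℕ`. [folklore] -/
theorem map_coe_poissonMeasure_singleton_coe (r : ℝ≥0) (k : ℕ) :
    ((poissonMeasure r).map ((↑) : ℕ → ℕ∞)) {(k : ℕ∞)} =
      ENNReal.ofReal (Real.exp (-r) * (r : ℝ) ^ k / k.factorial) := by
  rw [Measure.map_apply measurable_from_top (measurableSet_singleton _)]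
  have : ((↑) : ℕ → ℕ∞) ⁻¹' {(k : ℕ∞)} = {k} := by
    ext n
    simp only [mem_preimage, mem_singleton_iff, Nat.cast_inj]
  rw [this, poissonMeasure_singleton]

/-- The Poisson law transported to `ℕ∞` has no mass at `∞`. [folklore] -/
theorem map_coe_poissonMeasure_singleton_top (r : ℝ≥0) :
    ((poissonMeasure r).map ((↑) : ℕ → ℕ∞)) {(⊤ : ℕ∞)} = 0 := by
  rw [Measure.map_apply measurable_from_top (measurableSet_singleton _)]
  have : ((↑) : ℕ → ℕ∞) ⁻¹' {(⊤ : ℕ∞)} = ∅ := by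
    ext n
    simp
  rw [this, measure_empty]

/-- The Poisson recursion `(k+1) · Po(r)(k+1) = r · Po(r)(k)` in `ℝ≥0∞`. [folklore] -/
theorem succ_mul_poisson_succ (r : ℝ≥0) (k : ℕ) :
    ((k + 1 : ℕ) : ℝ≥0∞) * ENNReal.ofReal (Real.exp (-r) * (r : ℝ) ^ (k + 1) / (k + 1).factorial) =
      (r : ℝ≥0∞) * ENNReal.ofReal (Real.exp (-r) * (r : ℝ) ^ k / k.factorial) := by
  rw [← ENNReal.ofReal_natCast, ← ENNReal.ofReal_mul (Nat.cast_nonneg _), ← ENNReal.ofReal_coe_nnreal,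
    ← ENNReal.ofReal_mul NNReal.zero_le_coe]
  congr 1
  rw [Nat.factorial_succ, pow_succ]
  push_cast
  have hk : (k.factorial : ℝ) ≠ 0 := by positivity
  field_simp

/-- A sum over `ℕ∞` of a function vanishing at `∞` is the sum over `ℕ`. [folklore] -/
theorem tsum_enat_eq_tsum_nat {F : ℕ∞ → ℝ≥0∞} (hF : F ⊤ = 0) : ∑' j : ℕ∞, F j = ∑' k : ℕ, F k := by
  refine (Function.Injective.tsum_eq Nat.cast_injective fun j hj => ?_).symm
  induction j using ENat.recTopCoe with
  | top => exact absurd hF hj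
  | coe k => exact ⟨k, rfl⟩

/-- **The Poisson shift identity**: `∑ⱼ j Po(r)(j) g(j) = r ∑ⱼ Po(r)(j) g(j+1)` for every
`g : ℕ∞ → [0,∞]` (the law transported to `ℕ∞`). [folklore] -/
theorem tsum_enat_poisson_shift (r : ℝ≥0) (g : ℕ∞ → ℝ≥0∞) :
    ∑' j : ℕ∞, (j : ℝ≥0∞) * ((poissonMeasure r).map ((↑) : ℕ → ℕ∞)) {j} * g j =
      r * ∑' j : ℕ∞, ((poissonMeasure r).map ((↑) : ℕ → ℕ∞)) {j} * g (j + 1) := by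
  rw [tsum_enat_eq_tsum_nat (by rw [map_coe_poissonMeasure_singleton_top]; simp),
    tsum_enat_eq_tsum_nat (by rw [map_coe_poissonMeasure_singleton_top]; simp),
    tsum_eq_zero_add' ENNReal.summable]
  simp only [Nat.cast_zero, ENat.toENNReal_zero, zero_mul, zero_add]
  rw [← ENNReal.tsum_mul_left]
  refine tsum_congr fun k => ?_
  rw [map_coe_poissonMeasure_singleton_coe, map_coe_poissonMeasure_singleton_coe, ENat.toENNReal_coe,
    succ_mul_poisson_succ, mul_assoc]
  congr 2

variable {Ω : Type*} [MeasurableSpace Ω] {P : Measure Ω} [IsProbabilityMeasure P]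
  {W : Type*} [Fintype W] [DecidableEq W]

/-- **Independent Poisson counts: `𝔼[N_w · G(N)] = λ_w · 𝔼[G(N + e_w)]`.** For a finite family of
independent `ℕ∞`-valued random variables `N_w` with laws `Po(λ_w)` (transported to `ℕ∞`) and every
`G : (W → ℕ∞) → [0, ∞]`,
`∫ N_w · G(N) dP = λ_w ∫ G(update N w (N_w + 1)) dP`. Proof: the law of the vector `N` is the product
of the Poisson laws (`iIndepFun_iff_map_fun_eq_pi_map`), both sides are sums over `W → ℕ∞` against
product weights, and after splitting off the coordinate `w` (`Equiv.piSplitAt`) the claim is the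
Poisson shift identity `tsum_enat_poisson_shift` in that coordinate. Applied to the counts of the
atoms of a cylinder this is the computation `𝔼[1_A N(B)] = ∫_B P(c ∪ {a} ∈ A) ν(da)` at the heart
of the Mecke equation (Last–Penrose 2017, Thm 4.1). [cite: LastPenrose2017, Thm 4.1] -/
theorem lintegral_mul_eq_of_iIndepFun_poisson (N : W → Ω → ℕ∞) (hN : ∀ w, Measurable (N w))
    (r : W → ℝ≥0) (hlaw : ∀ w, P.map (N w) = (poissonMeasure (r w)).map ((↑) : ℕ → ℕ∞))
    (hind : iIndepFun N P) (w : W) (G : (W → ℕ∞) → ℝ≥0∞) :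
    ∫⁻ ω, (N w ω : ℝ≥0∞) * G (fun u => N u ω) ∂P =
      r w * ∫⁻ ω, G (Function.update (fun u => N u ω) w (N w ω + 1)) ∂P := by
  set V : Ω → (W → ℕ∞) := fun ω u => N u ω with hV
  have hVm : Measurable V := measurable_pi_lambda V fun u => hN u
  set μ : Measure (W → ℕ∞) := Measure.pi fun u => P.map (N u) with hμ
  have hVlaw : P.map V = μ := (iIndepFun_iff_map_fun_eq_pi_map (fun u => (hN u).aemeasurable)).1 hind
  haveI : ∀ u, IsProbabilityMeasure (P.map (N u)) := fun u =>
    Measure.isProbabilityMeasure_map (hN u).aemeasurable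
  -- transfer both integrals to the law `μ` of the count vector, a product of Poisson laws
  have hL : ∫⁻ ω, (N w ω : ℝ≥0∞) * G (fun u => N u ω) ∂P = ∫⁻ n, (n w : ℝ≥0∞) * G n ∂μ := by
    rw [← hVlaw, lintegral_map (measurable_of_countable _) hVm]
  have hR : ∫⁻ ω, G (Function.update (fun u => N u ω) w (N w ω + 1)) ∂P =
      ∫⁻ n, G (Function.update n w (n w + 1)) ∂μ := by
    rw [← hVlaw, lintegral_map (measurable_of_countable _) hVm]
  rw [hL, hR, lintegral_countable', lintegral_countable']
  set q : W → ℕ∞ → ℝ≥0∞ := fun u j => ((poissonMeasure (r u)).map ((↑) : ℕ → ℕ∞)) {j} with hq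
  have hμs : ∀ n : W → ℕ∞, μ {n} = q w (n w) * ∏ u : {u // u ≠ w}, q u (n u) := fun n => by
    rw [hμ, Measure.pi_singleton, Fintype.prod_eq_mul_prod_subtype_ne _ w]
    simp only [hq, hlaw]
  simp_rw [hμs]
  -- split off the coordinate `w`
  set e := Equiv.piSplitAt w (fun _ : W => ℕ∞) with he
  have hsymm_w : ∀ p : ℕ∞ × ({u // u ≠ w} → ℕ∞), e.symm p w = p.1 := fun p => by
    simp [he, Equiv.piSplitAt_symm_apply]
  have hsymm_ne : ∀ (p : ℕ∞ × ({u // u ≠ w} → ℕ∞)) (u : {u // u ≠ w}), e.symm p u = p.2 u := fun p u => by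
    simp [he, Equiv.piSplitAt_symm_apply, u.2]
  have hupd : ∀ p : ℕ∞ × ({u // u ≠ w} → ℕ∞),
      Function.update (e.symm p) w (p.1 + 1) = e.symm (p.1 + 1, p.2) := fun p => by
    funext u
    by_cases hu : u = w
    · subst hu
      rw [Function.update_self, hsymm_w]
    · rw [Function.update_of_ne hu, show e.symm p u = p.2 ⟨u, hu⟩ from hsymm_ne p ⟨u, hu⟩,
        show e.symm (p.1 + 1, p.2) u = p.2 ⟨u, hu⟩ from hsymm_ne (p.1 + 1, p.2) ⟨u, hu⟩]
  have h1 : ∑' n : W → ℕ∞, (n w : ℝ≥0∞) * G n * (q w (n w) * ∏ u : {u // u ≠ w}, q u (n u)) =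
      ∑' p : ℕ∞ × ({u // u ≠ w} → ℕ∞), (p.1 : ℝ≥0∞) * G (e.symm p) *
        (q w p.1 * ∏ u : {u // u ≠ w}, q u (p.2 u)) := by
    rw [← e.symm.tsum_eq]
    refine tsum_congr fun p => ?_
    simp_rw [hsymm_w, hsymm_ne]
  have h2 : ∑' n : W → ℕ∞, G (Function.update n w (n w + 1)) * (q w (n w) * ∏ u : {u // u ≠ w}, q u (n u)) =
      ∑' p : ℕ∞ × ({u // u ≠ w} → ℕ∞), G (e.symm (p.1 + 1, p.2)) *
        (q w p.1 * ∏ u : {u // u ≠ w}, q u (p.2 u)) := by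
    rw [← e.symm.tsum_eq]
    refine tsum_congr fun p => ?_
    rw [hsymm_w, hupd]
    simp_rw [hsymm_ne]
  rw [h1, h2, ENNReal.tsum_prod', ENNReal.tsum_prod', ENNReal.tsum_comm]
  conv_rhs => rw [ENNReal.tsum_comm]
  rw [← ENNReal.tsum_mul_left]
  refine tsum_congr fun n' => ?_
  have key := tsum_enat_poisson_shift (r w) (fun j => G (e.symm (j, n')))
  calc ∑' j : ℕ∞, (j : ℝ≥0∞) * G (e.symm (j, n')) * (q w j * ∏ u : {u // u ≠ w}, q u (n' u))
      = (∏ u : {u // u ≠ w}, q u (n' u)) *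
          ∑' j : ℕ∞, (j : ℝ≥0∞) * ((poissonMeasure (r w)).map ((↑) : ℕ → ℕ∞)) {j} * G (e.symm (j, n')) := by
        rw [← ENNReal.tsum_mul_left]
        exact tsum_congr fun j => by rw [hq]; ring
    _ = (∏ u : {u // u ≠ w}, q u (n' u)) *
          ((r w : ℝ≥0∞) * ∑' j : ℕ∞, ((poissonMeasure (r w)).map ((↑) : ℕ → ℕ∞)) {j} * G (e.symm (j + 1, n'))) := by
        rw [key]
    _ = r w * ∑' j : ℕ∞, G (e.symm (j + 1, n')) * (q w j * ∏ u : {u // u ≠ w}, q u (n' u)) := by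
        rw [← ENNReal.tsum_mul_left, ← ENNReal.tsum_mul_left, ← ENNReal.tsum_mul_left]
        exact tsum_congr fun j => by rw [hq]; ring

end IsPoissonPointProcess

end Literature.Analysis.FunctionSpaces
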